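import Summits.Ventures.CertifiedManyBodySolver.Upper.UMPSKernelTwins
import Summits.Ventures.CertifiedManyBodySolver.Upper.UMPSCellBondMatrix
import HarnessLib

/-!
# The bond matrix `g = bondMatrix t U` as an INTEGER matrix, and `(γ·1 ∓ g) ⪰ 0`

HONEST FRAMING: first certified bounds; not a superconductivity verdict; every number certified or
labelled float.

Venture `Ventures/CertifiedManyBodySolver` (sr-mbsolver). Two model-side inputs of the kernel-checked uMPS
certificates (`UMPSKernelCertificate.lean`, `Certificates/…_kernel.lean`):
* `bondMatrixZ t u` — the integer twin of METHOD-umps §1's bond operator `g = bondMatrix t (2u)` (tree leg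
  convention `k`: 0=∅, 1=↑, 2=↓, 3=↑↓; integer hopping `t`, even repulsion `U = 2u`), built from integer
  twins of the one-site matrices of `HubbardJordanWigner.lean`, with `castC (bondMatrixZ t u) = bondMatrix t (2u)`
  and the two instances the Venture's chain rows use (`bondMatrix 1 4`, `bondMatrix 1 8`);
* the Loewner bounds `(4|t| + 3U/2)·1 ∓ bondMatrix t U ⪰ 0` for `U ≥ 0` (from `4|t|·1 ∓ hop ⪰ 0` of
  `UMPSCellBondMatrix.lean` and `0 ≤ n↑n↓ ≤ 1`, `−1 ≤ 1 − n ≤ 1`) — the `γ` of Lemma P.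
Nothing here is a new fact: 0 `sorry`, 0 new `def … : Prop`.
-/

noncomputable section

namespace Summit.Ventures.CertifiedManyBodySolver.Upper

open Matrix Finset Literature.MathematicalPhysics.QuantumLattice
open Literature.MathematicalPhysics.QuantumLattice.JordanWigner Literature.LinearAlgebra.Matrix
open Literature.LinearAlgebra.Matrix.PolarOrthonormalization
open scoped ComplexOrder MatrixOrder Kronecker

/-! ### The bond matrix `g = bondMatrix t U` as an integer matrix, and `(γ·1 ∓ g) ⪰ 0` -/

section Bond

/-- Integer one-site annihilation matrices `c_↑ = e_1^2 + e_3^4`, `c_↓ = e_1^3 − e_2^4`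
(`siteAnnihilation_zero_eq`, `siteAnnihilation_one_eq`). -/
def siteAnnihilationZ (σ : Fin 2) : Matrix (Fin 4) (Fin 4) ℤ :=
  if σ = 0 then !![0, 1, 0, 0; 0, 0, 0, 0; 0, 0, 0, 1; 0, 0, 0, 0]
  else !![0, 0, 1, 0; 0, 0, 0, -1; 0, 0, 0, 0; 0, 0, 0, 0]

/-- Integer fermion parity `F = diag(1,−1,−1,1)` (`siteParity_eq`). -/
def siteParityZ : Matrix (Fin 4) (Fin 4) ℤ := !![1, 0, 0, 0; 0, -1, 0, 0; 0, 0, -1, 0; 0, 0, 0, 1]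

/-- Integer double occupancy `n↑n↓ = diag(0,0,0,1)` (`siteDouble_eq`). -/
def siteDoubleZ : Matrix (Fin 4) (Fin 4) ℤ := !![0, 0, 0, 0; 0, 0, 0, 0; 0, 0, 0, 0; 0, 0, 0, 1]

/-- Integer `1 − (n↑ + n↓) = diag(1,0,0,−1)`. -/
def oneSubTotalNumberZ : Matrix (Fin 4) (Fin 4) ℤ := !![1, 0, 0, 0; 0, 0, 0, 0; 0, 0, 0, 0; 0, 0, 0, -1]

/-- `castC (siteAnnihilationZ σ) = c_σ`. -/
theorem castC_siteAnnihilationZ (σ : Fin 2) : castC (siteAnnihilationZ σ) = siteAnnihilation σ := by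
  fin_cases σ
  · rw [show ((⟨0, by norm_num⟩ : Fin 2)) = 0 from rfl, siteAnnihilation_zero_eq]
    ext i j
    fin_cases i <;> fin_cases j <;> simp [castC_apply, siteAnnihilationZ]
  · rw [show ((⟨1, by norm_num⟩ : Fin 2)) = 1 from rfl, siteAnnihilation_one_eq]
    ext i j
    fin_cases i <;> fin_cases j <;> simp [castC_apply, siteAnnihilationZ]

/-- `castC (siteAnnihilationZ σ)ᵀ = c†_σ`. -/
theorem castC_siteAnnihilationZ_transpose (σ : Fin 2) :
    castC (siteAnnihilationZ σ)ᵀ = siteCreation σ := by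
  rw [siteCreation, ← castC_siteAnnihilationZ, conjTranspose_castC]

/-- `castC siteParityZ = F`. -/
theorem castC_siteParityZ : castC siteParityZ = siteParity := by
  rw [siteParity_eq]
  ext i j
  fin_cases i <;> fin_cases j <;> simp [castC_apply, siteParityZ]

/-- `castC siteDoubleZ = n↑n↓`. -/
theorem castC_siteDoubleZ : castC siteDoubleZ = siteDouble := by
  rw [siteDouble_eq]
  ext i j
  fin_cases i <;> fin_cases j <;> simp [castC_apply, siteDoubleZ]

/-- `castC oneSubTotalNumberZ = 1 − (n↑ + n↓)`. -/
theorem castC_oneSubTotalNumberZ : castC oneSubTotalNumberZ = 1 - siteTotalNumber := by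
  ext i j
  fin_cases i <;> fin_cases j <;>
    norm_num [castC_apply, oneSubTotalNumberZ, siteTotalNumber, siteCharge, siteOcc, diagonal]

/-- `castC` commutes with Kronecker products. -/
theorem castC_kronecker {m n : Type*} [Fintype m] [Fintype n] [DecidableEq m] [DecidableEq n]
    (A : Matrix m m ℤ) (B : Matrix n n ℤ) : castC (A ⊗ₖ B) = castC A ⊗ₖ castC B := by
  ext ⟨i, k⟩ ⟨j, l⟩
  simp [castC_apply, Matrix.kroneckerMap_apply]

/-- **Integer twin of the bond matrix**: `bondMatrixZ t u = 2^0 · bondMatrix t (2u)` for integer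
hopping `t` and EVEN repulsion `U = 2u` (then every entry of `g` is an integer):
`−t Σ_σ ((c†_σ F) ⊗ c_σ + (F c_σ) ⊗ c†_σ) + 2u (n↑n↓ ⊗ 1) + u ((1 − n) ⊗ 1)`. -/
def bondMatrixZ (t u : ℤ) : Matrix (Fin 4 × Fin 4) (Fin 4 × Fin 4) ℤ :=
  -t • ∑ σ : Fin 2, (((siteAnnihilationZ σ)ᵀ * siteParityZ) ⊗ₖ siteAnnihilationZ σ +
      (siteParityZ * siteAnnihilationZ σ) ⊗ₖ (siteAnnihilationZ σ)ᵀ) +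
    (2 * u) • (siteDoubleZ ⊗ₖ (1 : Matrix (Fin 4) (Fin 4) ℤ)) +
    u • (oneSubTotalNumberZ ⊗ₖ (1 : Matrix (Fin 4) (Fin 4) ℤ))

/-- `castC (bondMatrixZ t u) = bondMatrix t (2u)`. -/
theorem castC_bondMatrixZ (t u : ℤ) : castC (bondMatrixZ t u) = bondMatrix (t : ℝ) (2 * u : ℝ) := by
  unfold bondMatrixZ bondMatrix hopMatrix
  simp only [map_add, castC_smul, map_sum, map_mul, castC_kronecker, castC_siteAnnihilationZ,
    castC_siteAnnihilationZ_transpose, castC_siteParityZ, castC_siteDoubleZ, castC_oneSubTotalNumberZ,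
    map_one]
  push_cast
  congr 1
  ring_nf

/-- The bond matrix of the Venture's `U = 4` chain rows as an integer matrix:
`bondMatrix 1 4 = castC (bondMatrixZ 1 2)`. -/
theorem bondMatrix_one_four_eq_castC : bondMatrix 1 4 = castC (bondMatrixZ 1 2) := by
  rw [castC_bondMatrixZ]; norm_num

/-- The bond matrix of the `U = 8` rows: `bondMatrix 1 8 = castC (bondMatrixZ 1 4)`. -/
theorem bondMatrix_one_eight_eq_castC : bondMatrix 1 8 = castC (bondMatrixZ 1 4) := by
  rw [castC_bondMatrixZ]; norm_num

/-- `(A − B) ⊗ 1 = A ⊗ 1 − B ⊗ 1`. -/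
private theorem sub_kronecker_one (A B : Matrix (Fin 4) (Fin 4) ℂ) :
    (A - B) ⊗ₖ (1 : Matrix (Fin 4) (Fin 4) ℂ) = A ⊗ₖ 1 - B ⊗ₖ 1 := by
  ext ⟨i, k⟩ ⟨j, l⟩
  simp [Matrix.kroneckerMap_apply, sub_mul]

/-- `2·1 − (n↑ + n↓) ⪰ 0` on one site. -/
theorem posSemidef_two_smul_one_sub_siteTotalNumber :
    ((2 : ℂ) • (1 : Matrix (Fin 4) (Fin 4) ℂ) - siteTotalNumber).PosSemidef := by
  have h : ((2 : ℂ) • (1 : Matrix (Fin 4) (Fin 4) ℂ) - siteTotalNumber) =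
      diagonal (fun a => ((2 - siteCharge a : ℕ) : ℂ)) := by
    ext i j
    fin_cases i <;> fin_cases j <;>
      norm_num [siteTotalNumber, siteCharge, siteOcc, diagonal, Matrix.one_apply]
  rw [h]
  exact posSemidef_diagonal_iff.2 fun a => by exact_mod_cast Nat.zero_le _

/-- `1 + n↑n↓ ⪰ 0`-type helper: `1 ⊗ 1 = 1` on `ℂ⁴ ⊗ ℂ⁴`. -/
private theorem one_kronecker_one₄ :
    (1 : Matrix (Fin 4) (Fin 4) ℂ) ⊗ₖ (1 : Matrix (Fin 4) (Fin 4) ℂ) = 1 := Matrix.one_kronecker_one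

/-- `(A + B) ⊗ 1 = A ⊗ 1 + B ⊗ 1`. -/
private theorem add_kronecker_one (A B : Matrix (Fin 4) (Fin 4) ℂ) :
    (A + B) ⊗ₖ (1 : Matrix (Fin 4) (Fin 4) ℂ) = A ⊗ₖ 1 + B ⊗ₖ 1 := Matrix.add_kronecker _ _ _

/-- `(c • A) ⊗ 1 = c • (A ⊗ 1)`. -/
private theorem smul_kronecker_one (c : ℂ) (A : Matrix (Fin 4) (Fin 4) ℂ) :
    (c • A) ⊗ₖ (1 : Matrix (Fin 4) (Fin 4) ℂ) = c • (A ⊗ₖ 1) := Matrix.smul_kronecker _ _ _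

/-- **`(4|t| + 3U/2)·1 − g ⪰ 0`** for `U ≥ 0`: the bond operator is bounded above by `4|t| + 3U/2`
(`4|t|·1 − hop ⪰ 0`, `n↑n↓ ≤ 1`, `(1 − n) ≤ 1`). -/
theorem posSemidef_smul_one_sub_bondMatrix (t : ℝ) {U : ℝ} (hU : 0 ≤ U) :
    ((((4 * |t| + 3 * U / 2 : ℝ)) : ℂ) • (1 : Matrix (Fin 4 × Fin 4) (Fin 4 × Fin 4) ℂ) -
      bondMatrix t U).PosSemidef := by
  have e : (((4 * |t| + 3 * U / 2 : ℝ)) : ℂ) • (1 : Matrix (Fin 4 × Fin 4) (Fin 4 × Fin 4) ℂ) - bondMatrix t U =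
      ((((4 * |t| : ℝ)) : ℂ) • (1 : Matrix (Fin 4 × Fin 4) (Fin 4 × Fin 4) ℂ) - hopMatrix t) +
        (U : ℂ) • ((1 - siteDouble) ⊗ₖ (1 : Matrix (Fin 4) (Fin 4) ℂ)) +
        ((U / 2 : ℝ) : ℂ) • (siteTotalNumber ⊗ₖ (1 : Matrix (Fin 4) (Fin 4) ℂ)) := by
    rw [bondMatrix, sub_kronecker_one, sub_kronecker_one, one_kronecker_one₄]
    push_cast
    module
  rw [e]
  refine ((posSemidef_smul_one_sub_hopMatrix t).add ?_).add ?_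
  · exact (posSemidef_one_sub_siteDouble.kronecker PosSemidef.one).smul (Complex.zero_le_real.2 hU)
  · exact (posSemidef_siteTotalNumber.kronecker PosSemidef.one).smul
      (Complex.zero_le_real.2 (by positivity))

/-- **`(4|t| + 3U/2)·1 + g ⪰ 0`** for `U ≥ 0` (`4|t|·1 + hop ⪰ 0`, `n↑n↓ ⪰ 0`, `−(1 − n) ≤ 1`). -/
theorem posSemidef_smul_one_add_bondMatrix (t : ℝ) {U : ℝ} (hU : 0 ≤ U) :
    ((((4 * |t| + 3 * U / 2 : ℝ)) : ℂ) • (1 : Matrix (Fin 4 × Fin 4) (Fin 4 × Fin 4) ℂ) +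
      bondMatrix t U).PosSemidef := by
  have e : (((4 * |t| + 3 * U / 2 : ℝ)) : ℂ) • (1 : Matrix (Fin 4 × Fin 4) (Fin 4 × Fin 4) ℂ) + bondMatrix t U =
      ((((4 * |t| : ℝ)) : ℂ) • (1 : Matrix (Fin 4 × Fin 4) (Fin 4 × Fin 4) ℂ) + hopMatrix t) +
        (U : ℂ) • ((1 + siteDouble) ⊗ₖ (1 : Matrix (Fin 4) (Fin 4) ℂ)) +
        ((U / 2 : ℝ) : ℂ) • ((((2 : ℂ) • 1 - siteTotalNumber)) ⊗ₖ (1 : Matrix (Fin 4) (Fin 4) ℂ)) := by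
    rw [bondMatrix, sub_kronecker_one, sub_kronecker_one, add_kronecker_one, smul_kronecker_one,
      one_kronecker_one₄]
    push_cast
    module
  rw [e]
  refine ((posSemidef_smul_one_add_hopMatrix t).add ?_).add ?_
  · exact ((PosSemidef.one.add posSemidef_siteDouble).kronecker PosSemidef.one).smul
      (Complex.zero_le_real.2 hU)
  · exact (posSemidef_two_smul_one_sub_siteTotalNumber.kronecker PosSemidef.one).smul
      (Complex.zero_le_real.2 (by positivity))

end Bond

end Summit.Ventures.CertifiedManyBodySolver.Upper
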